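import Summits.AtomisticToContinuum.BoseEinsteinCondensation.Theorems.BECCutLineWeakDisorderAcrossCutBookkeeping
import HarnessLib

/-!
# Crux `TwoReplicaTransienceBound` (stmt-AtomisticToContinuum-9687), line `across-cut-thinning` v2:
# the IR chain of the composition in the partition-function normalisation (`stub_acrossCutIRChain`)

Support file (`--supports stmt-AtomisticToContinuum-9687`, lead c6; bookkeeping, does not close the item).
From the annealed block two-replica bound at depth `K` (`Λ₀₀ · ∫A_Q² ≤ c · B_Q²` for every block),
the mean-profile module (`8^K Σ B_Q² ≤ C₁ (Σ B_Q)²`) and the tail module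
(`(∫s_Φ²)⁵ ∫ s_Φ² R_Φ⁶ ≤ C₂ (∫ s_Φ² R_Φ)⁶`), for a non-degenerate bath (`Λ₀₀ ≠ 0`, `∫ s_Φ² ≠ 0`):
`∫ s_Φ² R_Φ⁶ ≤ C₂ (c C₁)⁶ ∫ s_Φ²` — sum the block bound over blocks, `Σ_Q B_Q ≤ ∫ s_Φ Z_n`,
Cauchy–Schwarz `(∫ s_Φ Z_n)² ≤ (∫ s_Φ²) Λ₀₀`, cancel `Λ₀₀`, `s_Φ² R_Φ ≤ 8^K S_K` pointwise, cancel
`(∫ s_Φ²)⁵`. (Steps (4c)–(4g) of the planner's checked-skeleton composition, verbatim, isolated as a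
lemma about partition-function objects only.)
-/

noncomputable section

open MeasureTheory Filter Set Finset
open scoped ENNReal NNReal Topology BigOperators

namespace Summit.AtomisticToContinuum.BoseEinsteinCondensation.Cruxes.TwoReplicaTransienceBound.AcrossCutThinning

open Literature.MathematicalPhysics.QuantumManyBody.BoseGas
open Summit.AtomisticToContinuum.BoseEinsteinCondensation.Cruxes.TwoReplicaTransienceBound.TracerDecoupling
open Summit.AtomisticToContinuum.BoseEinsteinCondensation.Cruxes.LandscapeBound.SiblingTelescopingChaining

variable {n : ℕ}

namespace Goal

/-- Registered bookkeeping stub `stub_acrossCutIRChain`: the IR chain of the composition (block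
two-replica bound + mean-profile module + tail module ⇒ the cancelled sixth-moment bound). -/
abbrev stub_acrossCutIRChain : Prop :=
  ∀ (n : ℕ) {v : ℝ → ℝ≥0∞}, Measurable v → ∀ {L T : ℝ}, 0 ≤ T → ∀ (K : ℕ) {cexp : ℝ≥0∞} {C₁ C₂ : ℝ},
    (∀ i : Fin 3 → Fin (2 ^ K),
      bathTwo v L T n * ∫⁻ Y : Config n, blockAmp v L T K i Y ^ 2 ≤ cexp * meanAmp v L T K i n ^ 2) →
    ((8 : ℝ≥0∞) ^ K * ∑ i : Fin 3 → Fin (2 ^ K), meanAmp v L T K i n ^ 2 ≤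
      ENNReal.ofReal C₁ * (∑ i : Fin 3 → Fin (2 ^ K), meanAmp v L T K i n) ^ 2) →
    ((∫⁻ Y : Config n, (∫⁻ x, partSlice v L T Y x) ^ 2) ^ 5 *
        ∫⁻ Y : Config n, (∫⁻ x, partSlice v L T Y x) ^ 2 * acrossPR (partSlice v L T Y) L K ^ 6 ≤
      ENNReal.ofReal C₂ *
        (∫⁻ Y : Config n, (∫⁻ x, partSlice v L T Y x) ^ 2 * acrossPR (partSlice v L T Y) L K) ^ 6) →
    bathTwo v L T n ≠ 0 → (∫⁻ Y : Config n, (∫⁻ x, partSlice v L T Y x) ^ 2) ≠ 0 →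
    ∫⁻ Y : Config n, (∫⁻ x, partSlice v L T Y x) ^ 2 * acrossPR (partSlice v L T Y) L K ^ 6 ≤
      ENNReal.ofReal C₂ * (cexp * ENNReal.ofReal C₁) ^ 6 *
        ∫⁻ Y : Config n, (∫⁻ x, partSlice v L T Y x) ^ 2

end Goal

/-- **The IR chain, tail cancelled** (see the module docstring). -/
theorem irChain_tail_cancelled {v : ℝ → ℝ≥0∞} (hvm : Measurable v) {L T : ℝ} (hT0 : 0 ≤ T) (K : ℕ)
    {cexp : ℝ≥0∞} {C₁ C₂ : ℝ}
    (hTR : ∀ i : Fin 3 → Fin (2 ^ K),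
      bathTwo v L T n * ∫⁻ Y : Config n, blockAmp v L T K i Y ^ 2 ≤ cexp * meanAmp v L T K i n ^ 2)
    (hM : (8 : ℝ≥0∞) ^ K * ∑ i : Fin 3 → Fin (2 ^ K), meanAmp v L T K i n ^ 2 ≤
      ENNReal.ofReal C₁ * (∑ i : Fin 3 → Fin (2 ^ K), meanAmp v L T K i n) ^ 2)
    (hP : (∫⁻ Y : Config n, (∫⁻ x, partSlice v L T Y x) ^ 2) ^ 5 *
        ∫⁻ Y : Config n, (∫⁻ x, partSlice v L T Y x) ^ 2 * acrossPR (partSlice v L T Y) L K ^ 6 ≤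
      ENNReal.ofReal C₂ *
        (∫⁻ Y : Config n, (∫⁻ x, partSlice v L T Y x) ^ 2 * acrossPR (partSlice v L T Y) L K) ^ 6)
    (hbath0 : bathTwo v L T n ≠ 0) (hIs0 : (∫⁻ Y : Config n, (∫⁻ x, partSlice v L T Y x) ^ 2) ≠ 0) :
    ∫⁻ Y : Config n, (∫⁻ x, partSlice v L T Y x) ^ 2 * acrossPR (partSlice v L T Y) L K ^ 6 ≤
      ENNReal.ofReal C₂ * (cexp * ENNReal.ofReal C₁) ^ 6 *
        ∫⁻ Y : Config n, (∫⁻ x, partSlice v L T Y x) ^ 2 := by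
  set sΦ : Config n → ℝ≥0∞ := fun Y => ∫⁻ x, partSlice v L T Y x with hsΦdef
  set RΦ : Config n → ℝ≥0∞ := fun Y => acrossPR (partSlice v L T Y) L K with hRΦdef
  have hsΦ_meas : Measurable sΦ := measurable_lintegral_partSlice hvm L T
  have hZ_meas : Measurable fun Y : Config n => fkPartition v L T Y := measurable_fkPartition_bath hvm L T
  have hbatht : bathTwo v L T n ≠ ⊤ := bathTwo_ne_top v L hT0 n
  have hIst : ∫⁻ Y : Config n, sΦ Y ^ 2 ≠ ⊤ := lintegral_sq_lintegral_partSlice_ne_top hvm hT0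
  -- (4c) summed over blocks: `Λ₀₀ · 8^K ∫ S_K ≤ c · 8^K Σ B_Q² ≤ c C₁ (Σ B_Q)²`
  have hsumS : ∫⁻ Y : Config n, levelSq (partSlice v L T Y) L K =
      ∑ i : Fin 3 → Fin (2 ^ K), ∫⁻ Y : Config n, blockAmp v L T K i Y ^ 2 := by
    unfold levelSq
    exact lintegral_finsetSum _ fun i _ => (measurable_blockAmp hvm L T K i).pow_const 2
  have h4c' : bathTwo v L T n * ∫⁻ Y : Config n, levelSq (partSlice v L T Y) L K ≤
      cexp * ∑ i : Fin 3 → Fin (2 ^ K), meanAmp v L T K i n ^ 2 := by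
    rw [hsumS, Finset.mul_sum, Finset.mul_sum]
    exact Finset.sum_le_sum fun i _ => hTR i
  have h4c : bathTwo v L T n * (8 ^ K * ∫⁻ Y : Config n, levelSq (partSlice v L T Y) L K) ≤
      cexp * (ENNReal.ofReal C₁ * (∑ i : Fin 3 → Fin (2 ^ K), meanAmp v L T K i n) ^ 2) := by
    calc bathTwo v L T n * (8 ^ K * ∫⁻ Y : Config n, levelSq (partSlice v L T Y) L K)
        = 8 ^ K * (bathTwo v L T n * ∫⁻ Y : Config n, levelSq (partSlice v L T Y) L K) := by ring
      _ ≤ 8 ^ K * (cexp * ∑ i : Fin 3 → Fin (2 ^ K), meanAmp v L T K i n ^ 2) :=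
          mul_le_mul' le_rfl h4c'
      _ = cexp * (8 ^ K * ∑ i : Fin 3 → Fin (2 ^ K), meanAmp v L T K i n ^ 2) := by ring
      _ ≤ cexp * (ENNReal.ofReal C₁ * (∑ i : Fin 3 → Fin (2 ^ K), meanAmp v L T K i n) ^ 2) :=
          mul_le_mul' le_rfl hM
  -- (4d) `Σ_Q B_Q ≤ ∫ s_Φ Z_n` and Cauchy–Schwarz `(∫ s_Φ Z_n)² ≤ (∫ s_Φ²) · Λ₀₀`
  have hsumB : ∑ i : Fin 3 → Fin (2 ^ K), meanAmp v L T K i n ≤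
      ∫⁻ Y : Config n, sΦ Y * fkPartition v L T Y := by
    have hswap : ∑ i : Fin 3 → Fin (2 ^ K), meanAmp v L T K i n =
        ∫⁻ Y : Config n, ∑ i : Fin 3 → Fin (2 ^ K), blockAmp v L T K i Y * fkPartition v L T Y := by
      unfold meanAmp
      exact (lintegral_finsetSum (f := fun i (Y : Config n) => blockAmp v L T K i Y * fkPartition v L T Y)
        _ (fun i _ => (measurable_blockAmp hvm L T K i).mul hZ_meas)).symm
    rw [hswap]
    refine lintegral_mono fun Y => ?_
    rw [← Finset.sum_mul]
    exact mul_le_mul' (sum_blockAmp_le L T K Y) le_rfl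
  have hCS2 : (∫⁻ Y : Config n, sΦ Y * fkPartition v L T Y) ^ 2 ≤
      (∫⁻ Y : Config n, sΦ Y ^ 2) * bathTwo v L T n := by
    have h1 := ENNReal.lintegral_mul_le_Lp_mul_Lq (volume : Measure (Config n))
      Real.HolderConjugate.two_two hsΦ_meas.aemeasurable hZ_meas.aemeasurable
    calc (∫⁻ Y : Config n, sΦ Y * fkPartition v L T Y) ^ 2
        ≤ ((∫⁻ Y : Config n, sΦ Y ^ (2 : ℝ)) ^ (1 / (2 : ℝ)) *
            (∫⁻ Y : Config n, fkPartition v L T Y ^ (2 : ℝ)) ^ (1 / (2 : ℝ))) ^ 2 := by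
          gcongr
          simpa only [Pi.mul_apply] using h1
      _ = (∫⁻ Y : Config n, sΦ Y ^ 2) * bathTwo v L T n := by
          rw [sq_rpow_half_mul_rpow_half]
          simp_rw [ENNReal.rpow_two]
          rfl
  -- `8^K ∫ S_K(Φ) ≤ c C₁ ∫ s_Φ²`
  have h4e : 8 ^ K * ∫⁻ Y : Config n, levelSq (partSlice v L T Y) L K ≤
      cexp * ENNReal.ofReal C₁ * ∫⁻ Y : Config n, sΦ Y ^ 2 := by
    have h := h4c.trans (mul_le_mul' le_rfl (mul_le_mul' le_rfl
      ((pow_le_pow_left' hsumB 2).trans hCS2)))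
    -- `Λ₀₀ · X ≤ c C₁ (∫ s_Φ²) Λ₀₀`
    have h' : bathTwo v L T n * (8 ^ K * ∫⁻ Y : Config n, levelSq (partSlice v L T Y) L K) ≤
        bathTwo v L T n * (cexp * ENNReal.ofReal C₁ * ∫⁻ Y : Config n, sΦ Y ^ 2) := by
      calc _ ≤ cexp * (ENNReal.ofReal C₁ * ((∫⁻ Y : Config n, sΦ Y ^ 2) * bathTwo v L T n)) := h
        _ = bathTwo v L T n * (cexp * ENNReal.ofReal C₁ * ∫⁻ Y : Config n, sΦ Y ^ 2) := by ring
    exact (ENNReal.mul_le_mul_iff_right hbath0 hbatht).1 h'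
  -- `∫ s_Φ² R_Φ ≤ 8^K ∫ S_K(Φ)` (pointwise `s² · (8^K S/s²) ≤ 8^K S`)
  have h4f : ∫⁻ Y : Config n, sΦ Y ^ 2 * RΦ Y ≤ 8 ^ K * ∫⁻ Y : Config n, levelSq (partSlice v L T Y) L K := by
    rw [← lintegral_const_mul _ (measurable_levelSq_partSlice hvm L T K)]
    refine lintegral_mono fun Y => ?_
    show sΦ Y ^ 2 * (8 ^ K * levelSq (partSlice v L T Y) L K / (∫⁻ x, partSlice v L T Y x) ^ 2) ≤ _
    exact ENNReal.mul_div_le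
  -- the tail module, cancelled: `∫ s_Φ² R_Φ⁶ ≤ C₂ (c C₁)⁶ ∫ s_Φ²`
  have h4g : ∫⁻ Y : Config n, sΦ Y ^ 2 * RΦ Y ^ 6 ≤
      ENNReal.ofReal C₂ * (cexp * ENNReal.ofReal C₁) ^ 6 * ∫⁻ Y : Config n, sΦ Y ^ 2 := by
    have hmean : ∫⁻ Y : Config n, sΦ Y ^ 2 * RΦ Y ≤ cexp * ENNReal.ofReal C₁ * ∫⁻ Y : Config n, sΦ Y ^ 2 :=
      h4f.trans h4e
    have h := hP
    have h' : (∫⁻ Y : Config n, sΦ Y ^ 2) ^ 5 * ∫⁻ Y : Config n, sΦ Y ^ 2 * RΦ Y ^ 6 ≤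
        (∫⁻ Y : Config n, sΦ Y ^ 2) ^ 5 *
          (ENNReal.ofReal C₂ * (cexp * ENNReal.ofReal C₁) ^ 6 * ∫⁻ Y : Config n, sΦ Y ^ 2) := by
      calc _ ≤ ENNReal.ofReal C₂ * (cexp * ENNReal.ofReal C₁ * ∫⁻ Y : Config n, sΦ Y ^ 2) ^ 6 := by
            refine h.trans ?_
            gcongr
        _ = (∫⁻ Y : Config n, sΦ Y ^ 2) ^ 5 *
              (ENNReal.ofReal C₂ * (cexp * ENNReal.ofReal C₁) ^ 6 * ∫⁻ Y : Config n, sΦ Y ^ 2) := by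
            ring
    exact (ENNReal.mul_le_mul_iff_right (pow_ne_zero 5 hIs0) (ENNReal.pow_ne_top hIst)).1 h'
  exact h4g

/-- PROVED bookkeeping stub `stub_acrossCutIRChain` (= `irChain_tail_cancelled`). -/
theorem stub_acrossCutIRChain : Goal.stub_acrossCutIRChain :=
  fun _n _v hvm _L _T hT0 K _cexp _C₁ _C₂ hTR hM hP hbath0 hIs0 =>
    irChain_tail_cancelled hvm hT0 K hTR hM hP hbath0 hIs0

end Summit.AtomisticToContinuum.BoseEinsteinCondensation.Cruxes.TwoReplicaTransienceBound.AcrossCutThinning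

end
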